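import Summits.BirchSwinnertonDyer.BirchSwinnertonDyer.Theorems.PrintCFramBottomClassIndexLawFiveLeBernoulliIntegral
import Mathlib.NumberTheory.LSeries.PrimesInAP
import Mathlib.LinearAlgebra.LinearIndependent.Basic
import Literature.NumberTheory.Automorphic.QuaternionLocalSplitReduction
import HarnessLib

/-!
# Crux `PrintCFram.BottomClassIndexLawFiveLe` (stmt-BirchSwinnertonDyer-20372), line `eisenstein-resource-bdp-line` (registry v10):
# UNIQUENESS OF THE EISENSTEIN PAIR — Kriz–Li's trace form `a_ℓ ≡ ψ(ℓ) + ψ⁻¹(ℓ)ω(ℓ)` determines `{ψ, ψ⁻¹ω}`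
# (cell `bsd-print-cfram`, width seat `bsd-line-cfram-p1-w3` g3; THEOREMS ONLY, `--supports` 20372; BSD is not proved by any of this)

HONEST FRAMING. Nothing here is a statement about BSD; no stub of the skeleton is closed. The Kriz–Li datum of the line
(v6–v10: `∃ … (f) (ψ : DirichletCharacter ℚ_[p] f) (ω) (εK), ψ.IsPrimitive ∧ IsTeichmullerCharacter ω ∧ hss ∧ (1) ∧ (3) ∧ ε_K ∧ (4)`)
quantifies over ALL character data `(f, ψ)` with the trace form `hss : ‖a_ℓ(W) − (ψ(ℓ) + ψ⁻¹(ℓ)ω(ℓ))‖_p < 1` (`ℓ ∤ pN`).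
w3 g2 built ONE such `ψ` per class (`KrizLiBinders.krizLiBinders_of_cmRamified`) and recorded as a dead end that «(4) quantified
over ALL admissible ψ needs the uniqueness of the Eisenstein pair (Brauer–Nesbitt + Dirichlet), not in the tree». THIS FILE PROVES IT:
two character data `(f₁, ψ₁)`, `(f₂, ψ₂)` with the same `ω` whose trace forms agree modulo `p` at every prime `ℓ ∤ N` (for instance
two `hss` for the same curve) satisfy, at the common level `M = f₁·f₂·p`,
`ψ₂↑ = ψ₁↑ ∨ ψ₂↑ = ψ₁⁻¹↑·ω↑` (`eq_or_eq_of_traceForm_congr`). Ingredients: Dirichlet's theorem on primes in residue classes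
(Mathlib `Nat.forall_exists_prime_gt_and_eq_mod`) to pass from primes to all units of `ℤ/M`; reduction of the (`p`-integral)
character values to `𝔽_p` (`PadicInt.toZMod`); Artin's independence of characters over the field `𝔽_p` (Mathlib
`linearIndependent_monoidHom`) for the relation `φ₁ + φ₁' = φ₂ + φ₂'` (`p ≠ 2`); and the RIGIDITY of `p`-adic roots of unity
(part I, `BernoulliIntegral.norm_apply_sub_one_eq_one`) to lift equalities from `𝔽_p` back to `ℚ_p`.
Consequence for the line (part II, `…EisensteinPairBernoulli`): hypothesis (4) of Kriz–Li Thm. 1.20 at a datum is a property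
of `(W, p, K'')` — the pair of Bernoulli numbers `{B_{1,ψ₀⁻¹ε_K}, B_{1,ψ₀ω⁻¹}}` is the same for every admissible `ψ` (swapped under
`ψ ↔ ψ⁻¹ω`, FMS §7.1).

beyond-print theorem: NO (Brauer–Nesbitt for a sum of two characters, classical).
References: [KrizLi2019] §2 (p. 11), Thm. 1.20, §7.1 (p. 43, «interchange ψ and ψ⁻¹ω»); [Washington1997] §5.1, Lemma 4.7-type
independence; [CurtisReiner1962] (30.16) Brauer–Nesbitt; Dirichlet's theorem (Mathlib `PrimesInAP`).
-/

set_option autoImplicit false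
set_option linter.dupNamespace false

noncomputable section

open scoped Classical
open DirichletCharacter Literature.NumberTheory.EllipticCurves.KrizLi2019
  Summit.BirchSwinnertonDyer.BirchSwinnertonDyer.Theorems.PrintCFram.BernoulliIntegral

namespace Summit.BirchSwinnertonDyer.BirchSwinnertonDyer.Theorems.PrintCFram.EisensteinPair

variable {p : ℕ} [hp : Fact p.Prime]

/-! ## §1 Reduction of character values to `𝔽_p` -/

/-- The value of a `ℚ_p`-valued Dirichlet character at a unit has norm exactly `1`. [cite: Washington1997, §5.1] -/
theorem norm_apply_coe_unit {n : ℕ} (χ : DirichletCharacter ℚ_[p] n) (u : (ZMod n)ˣ) : ‖χ (u : ZMod n)‖ = 1 := by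
  haveI : Fintype (ZMod n)ˣ := Fintype.ofFinite _
  have h1 : χ (u : ZMod n) ^ Fintype.card (ZMod n)ˣ = 1 := by
    rw [← map_pow, ← Units.val_pow_eq_pow_val, pow_card_eq_one, Units.val_one, map_one]
  have h2 := congrArg (‖·‖) h1
  simp only [norm_pow, norm_one] at h2
  exact (pow_eq_one_iff_of_nonneg (norm_nonneg _) Fintype.card_ne_zero).mp h2

/-- **Reduction homomorphism.** For a `ℚ_p`-valued Dirichlet character `χ` of level `n` there is a homomorphism
`φ : (ℤ/n)ˣ → 𝔽_p` with `φ(u) = χ(u) mod p` (the values are `p`-adic integers, part I `norm_apply_le_one`). Stated as an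
existence so that no definition is introduced. [cite: Washington1997, §5.1] -/
theorem exists_reduction_hom {n : ℕ} (χ : DirichletCharacter ℚ_[p] n) :
    ∃ φ : (ZMod n)ˣ →* ZMod p, ∀ u : (ZMod n)ˣ,
      φ u = PadicInt.toZMod (⟨χ (u : ZMod n), norm_apply_le_one χ _⟩ : ℤ_[p]) := by
  refine ⟨{ toFun := fun u => PadicInt.toZMod (⟨χ (u : ZMod n), norm_apply_le_one χ _⟩ : ℤ_[p]),
            map_one' := ?_, map_mul' := ?_ }, fun u => rfl⟩
  · have h1 : (1 : ℤ_[p]) = ⟨χ ((1 : (ZMod n)ˣ) : ZMod n), norm_apply_le_one χ _⟩ :=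
      PadicInt.ext (by
        rw [PadicInt.coe_one]
        change (1 : ℚ_[p]) = χ ((1 : (ZMod n)ˣ) : ZMod n)
        rw [Units.val_one, map_one])
    change PadicInt.toZMod _ = 1
    rw [← h1, map_one]
  · intro u v
    have hm : (⟨χ (u : ZMod n), norm_apply_le_one χ _⟩ * ⟨χ (v : ZMod n), norm_apply_le_one χ _⟩ : ℤ_[p]) =
        ⟨χ ((u * v : (ZMod n)ˣ) : ZMod n), norm_apply_le_one χ _⟩ :=
      PadicInt.ext (by
        rw [PadicInt.coe_mul]
        change χ (u : ZMod n) * χ (v : ZMod n) = χ ((u * v : (ZMod n)ˣ) : ZMod n)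
        rw [Units.val_mul, map_mul])
    change PadicInt.toZMod _ = PadicInt.toZMod _ * PadicInt.toZMod _
    rw [← map_mul, hm]

/-- **Lifting**: two characters of the same level whose values at units are congruent modulo `p` are EQUAL (`p` odd) —
rigidity of `p`-adic roots of unity (part I). [cite: Washington1997, §5.1 (ω(a) ≡ a mod p pins down the root of unity)] -/
theorem eq_of_forall_norm_sub_lt_one (hp2 : p ≠ 2) {n : ℕ} (χ₁ χ₂ : DirichletCharacter ℚ_[p] n)
    (h : ∀ u : (ZMod n)ˣ, ‖χ₁ (u : ZMod n) - χ₂ (u : ZMod n)‖ < 1) : χ₁ = χ₂ := by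
  -- `χ := χ₁ χ₂⁻¹` is `≡ 1` at every unit, hence `= 1`
  have key : ∀ u : (ZMod n)ˣ, (χ₁ * χ₂⁻¹) (u : ZMod n) = 1 := by
    intro u
    by_contra hne
    have h1 : ‖(χ₁ * χ₂⁻¹) (u : ZMod n) - 1‖ = 1 := norm_apply_sub_one_eq_one hp2 _ u hne
    have hχ₂ : ‖χ₂ (u : ZMod n)‖ = 1 := norm_apply_coe_unit χ₂ u
    have hne0 : χ₂ (u : ZMod n) ≠ 0 := fun h0 => by rw [h0, norm_zero] at hχ₂; exact zero_ne_one hχ₂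
    have e : (χ₁ * χ₂⁻¹) (u : ZMod n) - 1 = (χ₂ (u : ZMod n))⁻¹ * (χ₁ (u : ZMod n) - χ₂ (u : ZMod n)) := by
      rw [MulChar.mul_apply, MulChar.inv_apply_eq_inv']
      field_simp
    rw [e, norm_mul, norm_inv, hχ₂, inv_one, one_mul] at h1
    exact absurd h1 (ne_of_lt (h u))
  have hχ : χ₁ * χ₂⁻¹ = 1 := by
    apply MulChar.ext; intro u
    rw [key u, MulChar.one_apply_coe]
  calc χ₁ = χ₁ * χ₂⁻¹ * χ₂ := by rw [mul_assoc, inv_mul_cancel, mul_one]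
    _ = χ₂ := by rw [hχ, one_mul]

/-! ## §2 From primes to units: Dirichlet's theorem -/

/-- Every unit class modulo `M ≠ 0` contains a prime not dividing a given `N ≠ 0` (Dirichlet). [cite: Washington1997, Thm. 2.x (Dirichlet)] -/
theorem exists_prime_eq_not_dvd {M : ℕ} [NeZero M] (u : (ZMod M)ˣ) {N : ℕ} (hN : N ≠ 0) :
    ∃ ℓ : ℕ, ℓ.Prime ∧ ¬ ℓ ∣ N ∧ (ℓ : ZMod M) = (u : ZMod M) := by
  obtain ⟨ℓ, hgt, hprime, heq⟩ := Nat.forall_exists_prime_gt_and_eq_mod (u.isUnit) N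
  exact ⟨ℓ, hprime, fun hd => absurd (Nat.le_of_dvd (Nat.pos_of_ne_zero hN) hd) (not_le.mpr hgt), heq⟩

/-- A character value at a prime `ℓ` coprime to the bigger level, read at the bigger level. [folklore] -/
theorem changeLevel_apply_natCast {n M : ℕ} [NeZero M] (hnM : n ∣ M) (χ : DirichletCharacter ℚ_[p] n) {ℓ : ℕ}
    (hℓ : (ℓ : ℕ).Coprime M) : changeLevel hnM χ (ℓ : ZMod M) = χ (ℓ : ZMod n) := by
  have h := changeLevel_eq_cast_of_dvd' χ hnM (a := (ℓ : ℤ)) (Nat.isCoprime_iff_coprime.mpr hℓ)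
  simpa using h


/-! ## §3 Artin independence over `𝔽_p` and the uniqueness theorem -/

/-- **Four characters with `φ₁ + φ₁' = φ₂ + φ₂'` over a field of characteristic `≠ 2`**: then `φ₂ = φ₁` or `φ₂ = φ₁'`
(Artin/Dedekind independence of characters, Mathlib `linearIndependent_monoidHom`). [cite: CurtisReiner1962, (30.16) (Brauer–Nesbitt in dimension 2)] -/
theorem eq_or_eq_of_add_eq_add (hp2 : p ≠ 2) {G : Type*} [CommGroup G] (φ₁ φ₁' φ₂ φ₂' : G →* ZMod p)
    (h : ∀ g : G, φ₁ g + φ₁' g = φ₂ g + φ₂' g) : φ₂ = φ₁ ∨ φ₂ = φ₁' := by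
  by_contra hcon
  push Not at hcon
  obtain ⟨h1, h2⟩ := hcon
  have hLI := linearIndependent_monoidHom G (ZMod p)
  rw [linearIndependent_iff'] at hLI
  let s : Finset (G →* ZMod p) := {φ₁, φ₁', φ₂, φ₂'}
  let g : (G →* ZMod p) → ZMod p := fun f =>
    (if f = φ₁ then 1 else 0) + (if f = φ₁' then 1 else 0) - (if f = φ₂ then 1 else 0) - (if f = φ₂' then 1 else 0)
  have hsum : ∑ f ∈ s, g f • (f : G → ZMod p) = 0 := by
    have e : ∀ f ∈ s, g f • (f : G → ZMod p) =
        (if f = φ₁ then (f : G → ZMod p) else 0) + (if f = φ₁' then (f : G → ZMod p) else 0) -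
          (if f = φ₂ then (f : G → ZMod p) else 0) - (if f = φ₂' then (f : G → ZMod p) else 0) := by
      intro f _
      simp only [g, add_smul, sub_smul, ite_smul, one_smul, zero_smul]
    rw [Finset.sum_congr rfl e, Finset.sum_sub_distrib, Finset.sum_sub_distrib, Finset.sum_add_distrib,
      Finset.sum_ite_eq' s φ₁, Finset.sum_ite_eq' s φ₁', Finset.sum_ite_eq' s φ₂, Finset.sum_ite_eq' s φ₂',
      if_pos (by simp [s]), if_pos (by simp [s]), if_pos (by simp [s]), if_pos (by simp [s])]
    funext x
    simp only [Pi.sub_apply, Pi.add_apply, Pi.zero_apply]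
    rw [h x]; ring
  have hg := hLI s g hsum φ₂ (by simp [s])
  have h1' : (1 : ZMod p) ≠ 0 := one_ne_zero
  have h2' : (2 : ZMod p) ≠ 0 := by
    have : ((2 : ℕ) : ZMod p) ≠ 0 := by
      rw [Ne, ZMod.natCast_eq_zero_iff]
      intro hd
      exact hp2 ((Nat.prime_dvd_prime_iff_eq hp.out Nat.prime_two).mp hd)
    exact_mod_cast this
  have e1 : (if φ₂ = φ₁ then (1 : ZMod p) else 0) = 0 := if_neg h1
  have e2 : (if φ₂ = φ₁' then (1 : ZMod p) else 0) = 0 := if_neg h2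
  have e3 : (if φ₂ = φ₂ then (1 : ZMod p) else 0) = 1 := if_pos rfl
  change (if φ₂ = φ₁ then (1 : ZMod p) else 0) + (if φ₂ = φ₁' then 1 else 0) - (if φ₂ = φ₂ then 1 else 0) -
      (if φ₂ = φ₂' then 1 else 0) = 0 at hg
  rw [e1, e2, e3] at hg
  by_cases h3 : φ₂ = φ₂'
  · rw [if_pos h3] at hg
    apply h2'
    linear_combination (-1 : ZMod p) * hg
  · rw [if_neg h3] at hg
    apply h1'
    linear_combination (-1 : ZMod p) * hg

/-- **UNIQUENESS OF THE EISENSTEIN PAIR.** Let `p` be an odd prime, `ψ₁` (level `f₁`), `ψ₂` (level `f₂`) and `ω` (level `p`)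
`ℚ_p`-valued Dirichlet characters, `M` a common multiple of `f₁, f₂, p`, and suppose the two trace forms agree modulo `p` at
every prime `ℓ ∤ N` (`N ≠ 0`): `‖(ψ₁(ℓ) + ψ₁⁻¹(ℓ)ω(ℓ)) − (ψ₂(ℓ) + ψ₂⁻¹(ℓ)ω(ℓ))‖_p < 1` — e.g. two instances of Kriz–Li's
`hss` for the SAME curve. Then at level `M`: `ψ₂↑ = ψ₁↑` or `ψ₂↑ = ψ₁⁻¹↑·ω↑`. (Dirichlet ⟹ the congruence holds at every unit
of `ℤ/M`; reduce to `𝔽_p`; Artin independence; lift by rigidity of `p`-adic roots of unity.)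
[cite: KrizLi2019, §2 (p. 11) and §7.1 (p. 43, «interchange ψ and ψ⁻¹ω»)] [cite: CurtisReiner1962, (30.16)] [cite: Washington1997, §5.1] -/
theorem eq_or_eq_of_traceForm_congr (hp2 : p ≠ 2) {f₁ f₂ M : ℕ} [NeZero M]
    (h₁ : f₁ ∣ M) (h₂ : f₂ ∣ M) (hpM : p ∣ M)
    (ψ₁ : DirichletCharacter ℚ_[p] f₁) (ψ₂ : DirichletCharacter ℚ_[p] f₂) (ω : DirichletCharacter ℚ_[p] p)
    {N : ℕ} (hN : N ≠ 0)
    (h : ∀ ℓ : ℕ, ℓ.Prime → ¬ ℓ ∣ N →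
      ‖(ψ₁ (ℓ : ZMod f₁) + ψ₁⁻¹ (ℓ : ZMod f₁) * ω (ℓ : ZMod p)) -
        (ψ₂ (ℓ : ZMod f₂) + ψ₂⁻¹ (ℓ : ZMod f₂) * ω (ℓ : ZMod p))‖ < 1) :
    changeLevel h₂ ψ₂ = changeLevel h₁ ψ₁ ∨
      changeLevel h₂ ψ₂ = changeLevel h₁ ψ₁⁻¹ * changeLevel hpM ω := by
  have hM0 : M ≠ 0 := NeZero.ne M
  set Ψ₁ := changeLevel h₁ ψ₁ with hΨ₁
  set Ψ₁' := changeLevel h₁ ψ₁⁻¹ * changeLevel hpM ω with hΨ₁'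
  set Ψ₂ := changeLevel h₂ ψ₂ with hΨ₂
  set Ψ₂' := changeLevel h₂ ψ₂⁻¹ * changeLevel hpM ω with hΨ₂'
  -- Step A: the congruence at every unit of `ℤ/M`
  have hA : ∀ u : (ZMod M)ˣ,
      ‖(Ψ₁ (u : ZMod M) + Ψ₁' (u : ZMod M)) - (Ψ₂ (u : ZMod M) + Ψ₂' (u : ZMod M))‖ < 1 := by
    intro u
    obtain ⟨ℓ, hℓ, hℓN, hℓu⟩ := exists_prime_eq_not_dvd u (Nat.mul_ne_zero hN hM0)
    have hℓN' : ¬ ℓ ∣ N := fun hd => hℓN (dvd_mul_of_dvd_left hd M)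
    have hℓM : ℓ.Coprime M := by
      refine (Nat.Prime.coprime_iff_not_dvd hℓ).mpr fun hd => hℓN (dvd_mul_of_dvd_right hd N)
    have hℓf₁ : ℓ.Coprime f₁ := Nat.Coprime.coprime_dvd_right h₁ hℓM
    have hℓf₂ : ℓ.Coprime f₂ := Nat.Coprime.coprime_dvd_right h₂ hℓM
    have hℓp : ℓ.Coprime p := Nat.Coprime.coprime_dvd_right hpM hℓM
    rw [← hℓu, hΨ₁, hΨ₁', hΨ₂, hΨ₂', MulChar.mul_apply, MulChar.mul_apply,
      changeLevel_apply_natCast h₁ ψ₁ hℓM, changeLevel_apply_natCast h₁ ψ₁⁻¹ hℓM,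
      changeLevel_apply_natCast h₂ ψ₂ hℓM, changeLevel_apply_natCast h₂ ψ₂⁻¹ hℓM,
      changeLevel_apply_natCast hpM ω hℓM]
    exact h ℓ hℓ hℓN'
  -- Step B: reductions to `𝔽_p`
  obtain ⟨φ₁, hφ₁⟩ := exists_reduction_hom Ψ₁
  obtain ⟨φ₁', hφ₁'⟩ := exists_reduction_hom Ψ₁'
  obtain ⟨φ₂, hφ₂⟩ := exists_reduction_hom Ψ₂
  obtain ⟨φ₂', hφ₂'⟩ := exists_reduction_hom Ψ₂'
  have hB : ∀ u : (ZMod M)ˣ, φ₁ u + φ₁' u = φ₂ u + φ₂' u := by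
    intro u
    rw [hφ₁, hφ₁', hφ₂, hφ₂', ← map_add, ← map_add, Literature.NumberTheory.Automorphic.PadicInt.toZMod_eq_toZMod_iff]
    exact hA u
  -- Step C: Artin independence
  rcases eq_or_eq_of_add_eq_add hp2 φ₁ φ₁' φ₂ φ₂' hB with hC | hC
  · -- Step D: lift `φ₂ = φ₁`
    left
    refine eq_of_forall_norm_sub_lt_one hp2 Ψ₂ Ψ₁ fun u => ?_
    have := DFunLike.congr_fun hC u
    rw [hφ₂, hφ₁, Literature.NumberTheory.Automorphic.PadicInt.toZMod_eq_toZMod_iff] at this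
    exact this
  · right
    refine eq_of_forall_norm_sub_lt_one hp2 Ψ₂ Ψ₁' fun u => ?_
    have := DFunLike.congr_fun hC u
    rw [hφ₂, hφ₁', Literature.NumberTheory.Automorphic.PadicInt.toZMod_eq_toZMod_iff] at this
    exact this

end Summit.BirchSwinnertonDyer.BirchSwinnertonDyer.Theorems.PrintCFram.EisensteinPair

end
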